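import Summits.QuantumFields.YangMills.Theorems.BalabanUVNodesN19ChebyshevCurrencyLinearPrice
import Mathlib.MeasureTheory.Integral.IntervalIntegral.IntegrationByParts
import Mathlib.Analysis.PSeries

/-!
# YM-DAG node N19 (= NE7 proper) — MULTISCALE TELESCOPING, PART 5a: THE COSINE SERIES OF A C² LINK ON `[0, d]` — coefficients
# `|a_n| ≤ 2dV∕(π²n²)` by two integrations by parts (`V = |h′(0)| + |h′(d)| + κd`), uniform truncation error `2dV∕(π²N)`

Cell `pub-ymgap`, HUMAN RULING D-0062 (Track A) ∕ D-0149 (work-bound push), R141 (C) wider-strategy seat `pub-ymgap-dag-n19-e` (strategy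
s3 = ALTERNATIVE CURRENCY), generation g30, module 6 (lineage module 123).  Route `Summits/QuantumFields/YangMills/Theses/BalabanUVNodes.lean`,
cluster item K3⁸ «SpineGivenEndpointR13SepCoPHV» (stmt-QuantumFields-27366); filed `--supports` that item `--as helper` (it proves no registered
stub).  COUNT-NEUTRAL: [folklore] Fourier analysis over Mathlib (`has_pointwise_sum_fourier_series_of_summable`, integration by parts) and module 98
`…N19ChebyshevCurrencyLinearPrice` BY NAME (`integral_compCos_mul_sin_eq_zero`, `integral_compCos_mul_cos_two_pi`; its `hasSum_cosSeries` is re-run with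
the Lipschitz hypothesis replaced by summability of the coefficients); no laws, no scheme object, no Theses import; NOT a discharge claim.

PURPOSE.  PART 3 (`…N19OscillatingLinksMultiscale`, `exists_mvPolynomial_near_link_of_trigApprox`) prices a link of the ℓ¹-norm `h(Σ_i|x_i|)` by a
trigonometric approximation of `h` on `[0, d]` with controlled coefficients.  This module supplies that approximation for SMOOTH links: the cosine series
of `h` on `[0, d]` (the Fourier series of the even `2d`-periodic extension), `h(s) = (1∕d)∫_0^d h + Σ_{n≥1} a_n cos(πns∕d)`,
`a_n = (2∕d)∫_0^d h(u)cos(πnu∕d)du`, with `|a_n| ≤ 2dV∕(π²n²)` for `h ∈ C²` (`|h″| ≤ κ` on `[0,d]`, `V = |h′(0)| + |h′(d)| + κd`; two integrations by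
parts, the boundary terms of the first vanish) and hence the UNIFORM truncation bound `|h(s) − ((1∕d)∫h + Σ_{n≤N} a_n cos(πns∕d))| ≤ 2dV∕(π²N)`.
PART 5b (`…N19SmoothLinksMultiscale`) feeds it to PART 3: C² links at `≲ V·d·log²t∕t`.
§1 ★ `hasSum_cosSeries_of_summable` (module 98's convergence theorem for `G∘cos` under coefficient summability instead of Lipschitz) · §2 `hasDerivAt_sin_div` ·
`hasDerivAt_neg_cos_div` · ★ `integral_mul_cos_eq` (two integrations by parts) · ★ `abs_integral_mul_cos_le` (`|∫_0^d h cos(πn·∕d)| ≤ (d∕(πn))²V`) · §3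
`integral_compArccos_cos` (the substitution `φ = πs∕d`: `∫_0^π h(d·arccos(cos φ)∕π)cos(νφ)dφ = (π∕d)∫_0^d h(s)cos(νπs∕d)ds`) · §4 ★★ `hasSum_cosSeries_Icc`
(the cosine series of `h` at `s ∈ [0,d]`) · `sum_inv_succ_sq_shift_le` · ★★ `abs_sub_cosPartialSum_le` (THE TRUNCATION BOUND `2dV∕(π²N)`).

HONEST FRAMING (binding).  Elementary and [folklore]; NO consumer in the DAG today (a tool for the optimality map of the seat's own currency, degree
model); nothing of Bałaban's instantiated; NE7 NOT PRINTED, NOT proved; N19 NOT discharged; count-neutral.  One finite `T⁴` programme at fixed `ε`; nothing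
continuum ∕ `ℝ⁴` ∕ OS ∕ mass-gap ∕ Clay.  0 `def` ∕ 0 `sorry`.
-/

noncomputable section

open Real MeasureTheory Finset

namespace Summit.QuantumFields.YangMills.Theorems.BalabanUVNodesN19CosineSeriesSmooth

open Summit.QuantumFields.YangMills.Theorems.BalabanUVNodesN19ChebyshevCurrencyLinearPrice
  (integral_compCos_mul_sin_eq_zero integral_compCos_mul_cos_two_pi)

/-! ## §1 ★ The cosine series of `G∘cos` under coefficient summability [folklore] -/

/-- ★ **THE COSINE SERIES OF `G∘cos` CONVERGES WHEN ITS COEFFICIENTS ARE SUMMABLE**: for `G` continuous with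
`Σ_m |∫_0^π G(cos φ)cos((m+1)φ)dφ| < ∞` and `θ ∈ [0, 2π)`,
`G(cos θ) = (1∕π)∫_0^π G∘cos + Σ_{m≥0} (2∕π)(∫_0^π G(cos φ)cos((m+1)φ)dφ)·cos((m+1)θ)` — module 98's `hasSum_cosSeries` with its Lipschitz hypothesis
(used there only for the summability) replaced by the summability itself (`has_pointwise_sum_fourier_series_of_summable` on `ℝ∕2πℤ`). [folklore] -/
theorem hasSum_cosSeries_of_summable {G : ℝ → ℝ} (hG : Continuous G)
    (hsabs : Summable (fun m : ℕ => |∫ θ in (0 : ℝ)..π, G (Real.cos θ) * Real.cos (((m : ℝ) + 1) * θ)|))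
    {θ : ℝ} (hθ : θ ∈ Set.Ico 0 (2 * π)) :
    HasSum (fun m : ℕ => (2 / π * ∫ φ in (0 : ℝ)..π, G (Real.cos φ) * Real.cos (((m : ℝ) + 1) * φ)) *
        Real.cos (((m : ℝ) + 1) * θ))
      (G (Real.cos θ) - 1 / π * ∫ φ in (0 : ℝ)..π, G (Real.cos φ)) := by
  haveI : Fact (0 < 2 * π) := ⟨by positivity⟩
  -- `G∘cos` on the circle `ℝ ∕ 2πℤ`
  set fR : ℝ → ℂ := fun x => ((G (Real.cos x) : ℝ) : ℂ) with hfR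
  have hfRc : Continuous fR := Complex.continuous_ofReal.comp (hG.comp Real.continuous_cos)
  let FC : C(AddCircle (2 * π), ℂ) := ⟨AddCircle.liftIco (2 * π) 0 fR,
    AddCircle.liftIco_continuous (by simp [hfR]) hfRc.continuousOn⟩
  have hFapply : ∀ x : ℝ, x ∈ Set.Ico 0 (2 * π) → FC (x : AddCircle (2 * π)) = fR x := by
    intro x hx
    show AddCircle.liftIco (2 * π) 0 fR x = fR x
    exact AddCircle.liftIco_coe_apply (by rwa [zero_add])
  -- the coefficients: real, even in `n`
  set c : ℤ → ℝ := fun n => 1 / π * ∫ φ in (0 : ℝ)..π, G (Real.cos φ) * Real.cos (n * φ) with hc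
  have hc_neg : ∀ n : ℤ, c (-n) = c n := fun n => by
    simp only [hc, Int.cast_neg, neg_mul, Real.cos_neg]
  have hcoeff : ∀ n : ℤ, fourierCoeff FC n = ((c n : ℝ) : ℂ) := by
    intro n
    rw [fourierCoeff_eq_intervalIntegral FC n 0, zero_add]
    have hI : ∫ x in (0 : ℝ)..2 * π, (fourier (-n) (x : AddCircle (2 * π))) • FC x =
        ∫ x in (0 : ℝ)..2 * π, (((G (Real.cos x) * Real.cos (n * x) : ℝ) : ℂ) -
          Complex.I * ((G (Real.cos x) * Real.sin (n * x) : ℝ) : ℂ)) := by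
      refine intervalIntegral.integral_congr_Ioo_of_le (by positivity) fun x hx => ?_
      rw [fourier_coe_apply, hFapply x (Set.Ioo_subset_Ico_self hx), smul_eq_mul]
      simp only [hfR]
      have he : Complex.exp (2 * π * Complex.I * ((-n : ℤ) : ℂ) * x / ((2 * π : ℝ) : ℂ)) =
          Complex.exp ((-(n * x : ℝ) : ℂ) * Complex.I) := by
        congr 1; push_cast; field_simp
      rw [he, Complex.exp_mul_I, Complex.cos_neg, Complex.sin_neg, ← Complex.ofReal_cos, ← Complex.ofReal_sin]
      push_cast; ring
    rw [hI, intervalIntegral.integral_sub, intervalIntegral.integral_const_mul, intervalIntegral.integral_ofReal,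
      intervalIntegral.integral_ofReal, integral_compCos_mul_sin_eq_zero, integral_compCos_mul_cos_two_pi hG]
    · simp only [hc, Complex.ofReal_zero, mul_zero, sub_zero, Complex.real_smul]
      push_cast; field_simp
    · exact (Complex.continuous_ofReal.comp ((hG.comp Real.continuous_cos).mul
        (Real.continuous_cos.comp (continuous_const.mul continuous_id)))).intervalIntegrable _ _
    · exact (continuous_const.mul (Complex.continuous_ofReal.comp ((hG.comp Real.continuous_cos).mul
        (Real.continuous_sin.comp (continuous_const.mul continuous_id))))).intervalIntegrable _ _
  have hcnat : ∀ m : ℕ, c ((m : ℤ) + 1) = 1 / π * ∫ θ in (0 : ℝ)..π, G (Real.cos θ) * Real.cos (((m : ℝ) + 1) * θ) := by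
    intro m; simp only [hc]; push_cast; rfl
  have hsum : Summable (fourierCoeff FC) := by
    refine Summable.of_norm ?_
    have e : (fun n : ℤ => ‖fourierCoeff FC n‖) = fun n => |c n| := by
      funext n; rw [hcoeff, Complex.norm_real, Real.norm_eq_abs]
    rw [e]
    refine Summable.of_add_one_of_neg_add_one ?_ ?_
    · have : (fun m : ℕ => |c ((m : ℤ) + 1)|) = fun m : ℕ => 1 / π * |∫ θ in (0 : ℝ)..π, G (Real.cos θ) * Real.cos (((m : ℝ) + 1) * θ)| := by
        funext m; rw [hcnat, abs_mul, abs_of_pos (by positivity)]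
      rw [this]; exact hsabs.mul_left _
    · have : (fun m : ℕ => |c (-((m : ℤ) + 1))|) = fun m : ℕ => 1 / π * |∫ θ in (0 : ℝ)..π, G (Real.cos θ) * Real.cos (((m : ℝ) + 1) * θ)| := by
        funext m; rw [hc_neg, hcnat, abs_mul, abs_of_pos (by positivity)]
      rw [this]; exact hsabs.mul_left _
  -- the Fourier series at `θ`
  have hpt := has_pointwise_sum_fourier_series_of_summable hsum (θ : AddCircle (2 * π))
  have hfun : (fun n : ℤ => fourierCoeff FC n • fourier n (θ : AddCircle (2 * π))) =
      fun n : ℤ => ((c n : ℝ) : ℂ) * Complex.exp (((n * θ : ℝ) : ℂ) * Complex.I) := by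
    funext n
    rw [hcoeff, fourier_coe_apply, smul_eq_mul]
    congr 1; congr 1; push_cast; field_simp
  rw [hfun, hFapply θ hθ] at hpt
  -- fold `n ↔ −n`
  have hfold := hpt.nat_add_neg
  have hterm : ∀ m : ℕ, ((c m : ℝ) : ℂ) * Complex.exp ((((m : ℤ) * θ : ℝ) : ℂ) * Complex.I) +
      ((c (-(m : ℤ)) : ℝ) : ℂ) * Complex.exp ((((-(m : ℤ) : ℤ) * θ : ℝ) : ℂ) * Complex.I) =
      ((2 * c m * Real.cos (m * θ) : ℝ) : ℂ) := by
    intro m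
    rw [hc_neg]
    have ex : ((((-(m : ℤ) : ℤ)) * θ : ℝ) : ℂ) = -((((m : ℤ) * θ : ℝ) : ℂ)) := by push_cast; ring
    rw [ex, ← mul_add, ← Complex.two_cos, ← Complex.ofReal_cos]
    push_cast; ring
  simp only [Int.cast_natCast] at hterm hfold
  simp_rw [hterm] at hfold
  have h0 : ((c 0 : ℝ) : ℂ) * Complex.exp ((((0 : ℤ) : ℝ) * θ : ℝ) * Complex.I) = ((c 0 : ℝ) : ℂ) := by simp
  rw [h0, ← Complex.ofReal_add, Complex.hasSum_ofReal] at hfold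
  -- drop the `m = 0` term
  have hshift := (hasSum_nat_add_iff' (f := fun m : ℕ => 2 * c m * Real.cos (m * θ)) 1).2 hfold
  simp only [Finset.sum_range_one, Nat.cast_zero, zero_mul, Real.cos_zero, mul_one] at hshift
  have hc0 : c 0 = 1 / π * ∫ φ in (0 : ℝ)..π, G (Real.cos φ) := by simp [hc]
  have e2 : G (Real.cos θ) + c 0 - 2 * c 0 = G (Real.cos θ) - 1 / π * ∫ φ in (0 : ℝ)..π, G (Real.cos φ) := by
    rw [hc0]; ring
  rw [e2] at hshift
  refine (hshift.congr_fun ?_ : _)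
  intro m
  have : c ((m + 1 : ℕ) : ℤ) = 1 / π * ∫ φ in (0 : ℝ)..π, G (Real.cos φ) * Real.cos (((m : ℝ) + 1) * φ) := by
    simp only [hc]; push_cast; rfl
  simp only [this]
  push_cast; ring

/-! ## §2 ★ Two integrations by parts [folklore] -/

/-- `s ↦ sin(λs)∕λ` has derivative `cos(λs)` (`λ ≠ 0`). [bookkeeping] -/
theorem hasDerivAt_sin_div {lam : ℝ} (hlam : lam ≠ 0) (s : ℝ) :
    HasDerivAt (fun s => Real.sin (lam * s) / lam) (Real.cos (lam * s)) s := by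
  have h1 : HasDerivAt (fun x : ℝ => lam * x) lam s := by
    simpa using (hasDerivAt_id s).const_mul lam
  have h2 : HasDerivAt (fun x : ℝ => Real.sin (lam * x)) (Real.cos (lam * s) * lam) s :=
    (Real.hasDerivAt_sin (lam * s)).comp s h1
  have h3 := h2.div_const lam
  rwa [mul_div_cancel_right₀ _ hlam] at h3

/-- `s ↦ −cos(λs)∕λ` has derivative `sin(λs)` (`λ ≠ 0`). [bookkeeping] -/
theorem hasDerivAt_neg_cos_div {lam : ℝ} (hlam : lam ≠ 0) (s : ℝ) :
    HasDerivAt (fun s => -Real.cos (lam * s) / lam) (Real.sin (lam * s)) s := by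
  have h1 : HasDerivAt (fun x : ℝ => lam * x) lam s := by
    simpa using (hasDerivAt_id s).const_mul lam
  have h2 : HasDerivAt (fun x : ℝ => -Real.cos (lam * x)) (-(-Real.sin (lam * s) * lam)) s :=
    ((Real.hasDerivAt_cos (lam * s)).comp s h1).neg
  have h3 := h2.div_const lam
  rwa [neg_mul, neg_neg, mul_div_cancel_right₀ _ hlam] at h3

/-- ★ **TWO INTEGRATIONS BY PARTS.**  For `h ∈ C²` (`h′`, `h″` everywhere derivatives, `h″` continuous), `d > 0` and `λ = πn∕d` with `n ≥ 1`:
`∫_0^d h(s)cos(λs)ds = λ^{−2}(h′(d)cos(λd) − h′(0)) − λ^{−2}∫_0^d h″(s)cos(λs)ds` (the boundary terms of the first integration vanish: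
`sin(λd) = sin(πn) = 0`). [folklore] -/
theorem integral_mul_cos_eq {h h' h'' : ℝ → ℝ} (hh : ∀ s, HasDerivAt h (h' s) s) (hh' : ∀ s, HasDerivAt h' (h'' s) s)
    (hh'' : Continuous h'') {d : ℝ} (hd : 0 < d) {n : ℕ} (hn : 1 ≤ n) :
    ∫ s in (0 : ℝ)..d, h s * Real.cos (π * n / d * s) =
      (d / (π * n)) ^ 2 * (h' d * Real.cos (π * n) - h' 0) - (d / (π * n)) ^ 2 * ∫ s in (0 : ℝ)..d, h'' s * Real.cos (π * n / d * s) := by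
  set lam : ℝ := π * n / d with hlam
  have hn0 : (0 : ℝ) < n := by exact_mod_cast hn
  have hlam0 : lam ≠ 0 := by positivity
  have hcont_h : Continuous h := continuous_iff_continuousAt.2 fun s => (hh s).continuousAt
  have hcont_h' : Continuous h' := continuous_iff_continuousAt.2 fun s => (hh' s).continuousAt
  have hcos : Continuous fun s => Real.cos (lam * s) := Real.continuous_cos.comp (continuous_const.mul continuous_id)
  have hsin : Continuous fun s => Real.sin (lam * s) := Real.continuous_sin.comp (continuous_const.mul continuous_id)
  -- first integration by parts: `u = h`, `v = sin(λs)/λ`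
  have h1 := intervalIntegral.integral_mul_deriv_eq_deriv_mul (a := 0) (b := d) (u := h) (u' := h')
    (v := fun s => Real.sin (lam * s) / lam) (v' := fun s => Real.cos (lam * s))
    (fun s _ => hh s) (fun s _ => hasDerivAt_sin_div hlam0 s) (hcont_h'.intervalIntegrable _ _) (hcos.intervalIntegrable _ _)
  -- second: `u = h'`, `v = −cos(λs)/λ`
  have h2 := intervalIntegral.integral_mul_deriv_eq_deriv_mul (a := 0) (b := d) (u := h') (u' := h'')
    (v := fun s => -Real.cos (lam * s) / lam) (v' := fun s => Real.sin (lam * s))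
    (fun s _ => hh' s) (fun s _ => hasDerivAt_neg_cos_div hlam0 s) (hh''.intervalIntegrable _ _) (hsin.intervalIntegrable _ _)
  have hsd : Real.sin (lam * d) = 0 := by
    have : lam * d = n * π := by simp only [hlam]; field_simp
    rw [this, Real.sin_nat_mul_pi]
  have hcd : Real.cos (lam * d) = Real.cos (π * n) := by
    congr 1; simp only [hlam]; field_simp
  simp only [mul_zero, Real.sin_zero, Real.cos_zero, zero_div, hsd] at h1 h2
  -- `∫ h' · sin(λs)/λ = (1/λ) ∫ h' sin(λs)`
  have e1 : ∫ s in (0 : ℝ)..d, h' s * (Real.sin (lam * s) / lam) = (1 / lam) * ∫ s in (0 : ℝ)..d, h' s * Real.sin (lam * s) := by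
    rw [← intervalIntegral.integral_const_mul]
    refine intervalIntegral.integral_congr fun s _ => ?_
    field_simp
  have e2 : ∫ s in (0 : ℝ)..d, h'' s * (-Real.cos (lam * s) / lam) = -(1 / lam) * ∫ s in (0 : ℝ)..d, h'' s * Real.cos (lam * s) := by
    rw [← intervalIntegral.integral_const_mul]
    refine intervalIntegral.integral_congr fun s _ => ?_
    field_simp
  rw [e1] at h1
  rw [e2, hcd] at h2
  have e3 : (d / (π * n)) ^ 2 = 1 / lam ^ 2 := by rw [hlam]; field_simp
  rw [h1, h2, e3]
  field_simp
  ring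

/-- ★ **THE COEFFICIENT BOUND**: with `|h″| ≤ κ` on `[0,d]`, `|∫_0^d h(s)cos(πns∕d)ds| ≤ (d∕(πn))²·(|h′(0)| + |h′(d)| + κd)` (`n ≥ 1`). [folklore] -/
theorem abs_integral_mul_cos_le {h h' h'' : ℝ → ℝ} (hh : ∀ s, HasDerivAt h (h' s) s) (hh' : ∀ s, HasDerivAt h' (h'' s) s)
    (hh'' : Continuous h'') {d κ : ℝ} (hd : 0 < d) (hκ : ∀ s ∈ Set.Icc (0 : ℝ) d, |h'' s| ≤ κ) {n : ℕ} (hn : 1 ≤ n) :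
    |∫ s in (0 : ℝ)..d, h s * Real.cos (π * n / d * s)| ≤ (d / (π * n)) ^ 2 * (|h' 0| + |h' d| + κ * d) := by
  rw [integral_mul_cos_eq hh hh' hh'' hd hn]
  have hI : |∫ s in (0 : ℝ)..d, h'' s * Real.cos (π * n / d * s)| ≤ κ * d := by
    have h := intervalIntegral.norm_integral_le_of_norm_le_const (a := 0) (b := d) (C := κ)
      (f := fun s => h'' s * Real.cos (π * n / d * s)) ?_
    · rw [Real.norm_eq_abs, sub_zero, abs_of_pos hd] at h; exact h
    · intro s hs
      rw [Set.uIoc_of_le hd.le] at hs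
      rw [Real.norm_eq_abs, abs_mul]
      calc |h'' s| * |Real.cos (π * n / d * s)| ≤ κ * 1 :=
            mul_le_mul (hκ s ⟨hs.1.le, hs.2⟩) (Real.abs_cos_le_one _) (abs_nonneg _) ((abs_nonneg _).trans (hκ s ⟨hs.1.le, hs.2⟩))
        _ = κ := mul_one _
  have hc2 : 0 ≤ (d / (π * n)) ^ 2 := sq_nonneg _
  calc |(d / (π * n)) ^ 2 * (h' d * Real.cos (π * n) - h' 0) - (d / (π * n)) ^ 2 * ∫ s in (0 : ℝ)..d, h'' s * Real.cos (π * n / d * s)|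
      ≤ |(d / (π * n)) ^ 2 * (h' d * Real.cos (π * n) - h' 0)| + |(d / (π * n)) ^ 2 * ∫ s in (0 : ℝ)..d, h'' s * Real.cos (π * n / d * s)| :=
        abs_sub _ _
    _ = (d / (π * n)) ^ 2 * |h' d * Real.cos (π * n) - h' 0| + (d / (π * n)) ^ 2 * |∫ s in (0 : ℝ)..d, h'' s * Real.cos (π * n / d * s)| := by
        rw [abs_mul, abs_mul, abs_of_nonneg hc2]
    _ ≤ (d / (π * n)) ^ 2 * (|h' d| + |h' 0|) + (d / (π * n)) ^ 2 * (κ * d) := by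
        refine add_le_add (mul_le_mul_of_nonneg_left ?_ hc2) (mul_le_mul_of_nonneg_left hI hc2)
        calc |h' d * Real.cos (π * n) - h' 0| ≤ |h' d * Real.cos (π * n)| + |h' 0| := abs_sub _ _
          _ ≤ |h' d| * 1 + |h' 0| := by
              rw [abs_mul]; exact add_le_add (mul_le_mul_of_nonneg_left (Real.abs_cos_le_one _) (abs_nonneg _)) le_rfl
          _ = |h' d| + |h' 0| := by ring
    _ = (d / (π * n)) ^ 2 * (|h' 0| + |h' d| + κ * d) := by ring

/-! ## §3 The substitution `φ = πs∕d` [bookkeeping] -/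

/-- `∫_0^π h(d·arccos(cos φ)∕π)·cos(νφ)dφ = (π∕d)·∫_0^d h(s)cos(νπs∕d)ds` (`d > 0`; on `[0,π]`, `arccos(cos φ) = φ`). [bookkeeping] -/
theorem integral_compArccos_cos (h : ℝ → ℝ) {d : ℝ} (hd : 0 < d) (ν : ℝ) :
    ∫ φ in (0 : ℝ)..π, h (d * Real.arccos (Real.cos φ) / π) * Real.cos (ν * φ) =
      π / d * ∫ s in (0 : ℝ)..d, h s * Real.cos (ν * (π / d * s)) := by
  have hπ := Real.pi_pos
  have e1 : ∫ φ in (0 : ℝ)..π, h (d * Real.arccos (Real.cos φ) / π) * Real.cos (ν * φ) =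
      ∫ φ in (0 : ℝ)..π, h (d * φ / π) * Real.cos (ν * φ) := by
    refine intervalIntegral.integral_congr fun φ hφ => ?_
    rw [Set.uIcc_of_le hπ.le] at hφ
    show h (d * Real.arccos (Real.cos φ) / π) * Real.cos (ν * φ) = h (d * φ / π) * Real.cos (ν * φ)
    rw [Real.arccos_cos hφ.1 hφ.2]
  rw [e1]
  have e2 := intervalIntegral.smul_integral_comp_mul_left (f := fun φ => h (d * φ / π) * Real.cos (ν * φ)) (a := 0) (b := d) (π / d)
  rw [smul_eq_mul, mul_zero, show π / d * d = π by field_simp] at e2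
  rw [← e2]
  congr 1
  refine intervalIntegral.integral_congr fun s _ => ?_
  show h (d * (π / d * s) / π) * Real.cos (ν * (π / d * s)) = h s * Real.cos (ν * (π / d * s))
  congr 2
  field_simp

/-! ## §4 ★★ The cosine series of a C² link on `[0, d]` and its truncation [folklore] -/

/-- ★★ **THE COSINE SERIES OF `h` ON `[0,d]`.**  For `h ∈ C²` (as in §2, `|h″| ≤ κ` on `[0,d]`), `d > 0` and `s ∈ [0,d]`:
`h(s) = (1∕d)∫_0^d h + Σ_{m≥0} a_{m+1}cos(π(m+1)s∕d)`, `a_n = (2∕d)∫_0^d h(u)cos(πnu∕d)du` (the coefficients are summable by §2: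
`|a_n| ≤ 2dV∕(π²n²)`; §1 on `G = h(d·arccos(·)∕π)`, `θ = πs∕d`). [folklore] -/
theorem hasSum_cosSeries_Icc {h h' h'' : ℝ → ℝ} (hh : ∀ s, HasDerivAt h (h' s) s) (hh' : ∀ s, HasDerivAt h' (h'' s) s)
    (hh'' : Continuous h'') {d κ : ℝ} (hd : 0 < d) (hκ : ∀ s ∈ Set.Icc (0 : ℝ) d, |h'' s| ≤ κ) {s : ℝ} (hs : s ∈ Set.Icc (0 : ℝ) d) :
    HasSum (fun m : ℕ => (2 / d * ∫ u in (0 : ℝ)..d, h u * Real.cos (π * ((m : ℝ) + 1) / d * u)) *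
        Real.cos (π * ((m : ℝ) + 1) / d * s))
      (h s - 1 / d * ∫ u in (0 : ℝ)..d, h u) := by
  have hπ := Real.pi_pos
  have hcont_h : Continuous h := continuous_iff_continuousAt.2 fun s => (hh s).continuousAt
  set G : ℝ → ℝ := fun y => h (d * Real.arccos y / π) with hG
  have hGc : Continuous G := hcont_h.comp ((continuous_const.mul Real.continuous_arccos).div_const _)
  -- coefficients of `G∘cos` in terms of `h`
  have hcoef : ∀ ν : ℝ, ∫ φ in (0 : ℝ)..π, G (Real.cos φ) * Real.cos (ν * φ) = π / d * ∫ u in (0 : ℝ)..d, h u * Real.cos (ν * (π / d * u)) :=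
    fun ν => integral_compArccos_cos h hd ν
  -- summability
  have hsabs : Summable (fun m : ℕ => |∫ θ in (0 : ℝ)..π, G (Real.cos θ) * Real.cos (((m : ℝ) + 1) * θ)|) := by
    have hmaj : ∀ m : ℕ, |∫ θ in (0 : ℝ)..π, G (Real.cos θ) * Real.cos (((m : ℝ) + 1) * θ)| ≤
        (d * (|h' 0| + |h' d| + κ * d) / π) * (1 / ((m : ℝ) + 1) ^ 2) := by
      intro m
      rw [hcoef, abs_mul, abs_of_pos (by positivity : (0 : ℝ) < π / d)]
      have hn : 1 ≤ m + 1 := Nat.succ_le_succ (Nat.zero_le m)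
      have hb := abs_integral_mul_cos_le hh hh' hh'' hd hκ hn
      have e : (fun u => h u * Real.cos (((m : ℝ) + 1) * (π / d * u))) = fun u => h u * Real.cos (π * ((m + 1 : ℕ) : ℝ) / d * u) := by
        funext u; rw [show ((m : ℝ) + 1) * (π / d * u) = π * ((m + 1 : ℕ) : ℝ) / d * u by push_cast; ring]
      rw [e]
      calc π / d * |∫ u in (0 : ℝ)..d, h u * Real.cos (π * ((m + 1 : ℕ) : ℝ) / d * u)|
          ≤ π / d * ((d / (π * ((m + 1 : ℕ) : ℝ))) ^ 2 * (|h' 0| + |h' d| + κ * d)) := mul_le_mul_of_nonneg_left hb (by positivity)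
        _ = (d * (|h' 0| + |h' d| + κ * d) / π) * (1 / ((m : ℝ) + 1) ^ 2) := by push_cast; field_simp
    have hS : Summable (fun m : ℕ => (d * (|h' 0| + |h' d| + κ * d) / π) * (1 / ((m : ℝ) + 1) ^ 2)) := by
      refine Summable.mul_left _ ?_
      have h2 := (summable_nat_add_iff 1).2 (Real.summable_one_div_nat_pow.2 one_lt_two)
      refine h2.congr fun m => ?_
      push_cast; ring
    exact Summable.of_nonneg_of_le (fun m => abs_nonneg _) hmaj hS
  -- §1 at `θ = πs/d`
  have hθ : π / d * s ∈ Set.Ico 0 (2 * π) := by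
    refine ⟨mul_nonneg (by positivity) hs.1, ?_⟩
    have : π / d * s ≤ π / d * d := mul_le_mul_of_nonneg_left hs.2 (by positivity)
    rw [show π / d * d = π by field_simp] at this
    linarith
  have hser := hasSum_cosSeries_of_summable hGc hsabs hθ
  have hGs : G (Real.cos (π / d * s)) = h s := by
    have h0 : 0 ≤ π / d * s := mul_nonneg (by positivity) hs.1
    have h1 : π / d * s ≤ π := by
      have : π / d * s ≤ π / d * d := mul_le_mul_of_nonneg_left hs.2 (by positivity)
      rwa [show π / d * d = π by field_simp] at this
    simp only [hG]
    rw [Real.arccos_cos h0 h1]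
    congr 1; field_simp
  have hmean : 1 / π * ∫ φ in (0 : ℝ)..π, G (Real.cos φ) = 1 / d * ∫ u in (0 : ℝ)..d, h u := by
    have h0 := hcoef 0
    simp only [zero_mul, Real.cos_zero, mul_one] at h0
    rw [h0]; field_simp
  rw [hGs, hmean] at hser
  refine hser.congr_fun fun m => ?_
  rw [hcoef]
  have e : (fun u => h u * Real.cos (((m : ℝ) + 1) * (π / d * u))) = fun u => h u * Real.cos (π * ((m : ℝ) + 1) / d * u) := by
    funext u; ring_nf
  rw [e, show ((m : ℝ) + 1) * (π / d * s) = π * ((m : ℝ) + 1) / d * s by ring]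
  field_simp

/-- `Σ_{i<n} 1∕(i+N+1)² ≤ 1∕N − 1∕(N+n)` for `N ≥ 1` (telescoping: `(k+1)² ≥ k(k+1)`). [folklore] -/
theorem sum_inv_succ_sq_shift_le {N : ℕ} (hN : 1 ≤ N) (n : ℕ) :
    ∑ i ∈ range n, 1 / (((i + N : ℕ) : ℝ) + 1) ^ 2 ≤ 1 / N - 1 / ((N : ℝ) + n) := by
  induction n with
  | zero => simp
  | succ n ih =>
    rw [Finset.sum_range_succ]
    have hk : (1 : ℝ) ≤ (n + N : ℕ) := by exact_mod_cast le_add_left hN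
    have hstep : 1 / (((n + N : ℕ) : ℝ) + 1) ^ 2 ≤ 1 / ((N : ℝ) + n) - 1 / ((N : ℝ) + (n + 1 : ℕ)) := by
      have e : ((n + N : ℕ) : ℝ) = (N : ℝ) + n := by push_cast; ring
      rw [e] at hk ⊢
      push_cast
      rw [div_sub_div _ _ (by positivity) (by positivity), div_le_div_iff₀ (by positivity) (by positivity)]
      nlinarith
    push_cast at ih hstep ⊢
    linarith

/-- ★★ **THE TRUNCATION BOUND.**  For `h ∈ C²` (`|h″| ≤ κ` on `[0,d]`, `V = |h′(0)| + |h′(d)| + κd`), `d > 0`, `N ≥ 1` and `s ∈ [0,d]`: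
`|h(s) − ((1∕d)∫_0^d h + Σ_{m<N} a_{m+1}cos(π(m+1)s∕d))| ≤ 2dV∕(π²N)` (tail of §4: `Σ_{n>N}|a_n| ≤ (2dV∕π²)Σ_{n>N} n^{−2} ≤ 2dV∕(π²N)`).
[folklore] -/
theorem abs_sub_cosPartialSum_le {h h' h'' : ℝ → ℝ} (hh : ∀ s, HasDerivAt h (h' s) s) (hh' : ∀ s, HasDerivAt h' (h'' s) s)
    (hh'' : Continuous h'') {d κ : ℝ} (hd : 0 < d) (hκ : ∀ s ∈ Set.Icc (0 : ℝ) d, |h'' s| ≤ κ) {N : ℕ} (hN : 1 ≤ N)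
    {s : ℝ} (hs : s ∈ Set.Icc (0 : ℝ) d) :
    |h s - (1 / d * (∫ u in (0 : ℝ)..d, h u) +
        ∑ m ∈ range N, (2 / d * ∫ u in (0 : ℝ)..d, h u * Real.cos (π * ((m : ℝ) + 1) / d * u)) *
          Real.cos (π * ((m : ℝ) + 1) / d * s))| ≤
      2 * d * (|h' 0| + |h' d| + κ * d) / (π ^ 2 * N) := by
  have hπ := Real.pi_pos
  set V : ℝ := |h' 0| + |h' d| + κ * d with hV
  have hV0 : 0 ≤ V := by
    have : 0 ≤ κ := (abs_nonneg _).trans (hκ 0 ⟨le_rfl, hd.le⟩)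
    positivity
  set f : ℕ → ℝ := fun m => (2 / d * ∫ u in (0 : ℝ)..d, h u * Real.cos (π * ((m : ℝ) + 1) / d * u)) *
    Real.cos (π * ((m : ℝ) + 1) / d * s) with hf
  have hsum : HasSum f (h s - 1 / d * ∫ u in (0 : ℝ)..d, h u) := hasSum_cosSeries_Icc hh hh' hh'' hd hκ hs
  have htail : HasSum (fun i => f (i + N)) (h s - 1 / d * (∫ u in (0 : ℝ)..d, h u) - ∑ m ∈ range N, f m) :=
    (hasSum_nat_add_iff' N).2 hsum
  -- termwise bound on the tail
  set g : ℕ → ℝ := fun i => (2 * d * V / π ^ 2) * (1 / (((i + N : ℕ) : ℝ) + 1) ^ 2) with hg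
  have hfg : ∀ i, |f (i + N)| ≤ g i := by
    intro i
    have hn : 1 ≤ i + N + 1 := Nat.succ_le_succ (Nat.zero_le _)
    have hb := abs_integral_mul_cos_le hh hh' hh'' hd hκ hn
    simp only [hf, hg, abs_mul]
    have e : (fun u => h u * Real.cos (π * (((i + N : ℕ) : ℝ) + 1) / d * u)) = fun u => h u * Real.cos (π * ((i + N + 1 : ℕ) : ℝ) / d * u) := by
      funext u; rw [show (((i + N : ℕ) : ℝ) + 1) = ((i + N + 1 : ℕ) : ℝ) by push_cast; ring]
    rw [e, abs_of_pos (by positivity : (0 : ℝ) < 2 / d)]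
    calc 2 / d * |∫ u in (0 : ℝ)..d, h u * Real.cos (π * ((i + N + 1 : ℕ) : ℝ) / d * u)| * |Real.cos (π * (((i + N : ℕ) : ℝ) + 1) / d * s)|
        ≤ 2 / d * ((d / (π * ((i + N + 1 : ℕ) : ℝ))) ^ 2 * V) * 1 :=
          mul_le_mul (mul_le_mul_of_nonneg_left hb (by positivity)) (Real.abs_cos_le_one _) (abs_nonneg _) (by positivity)
      _ = (2 * d * V / π ^ 2) * (1 / (((i + N : ℕ) : ℝ) + 1) ^ 2) := by push_cast; field_simp
  have hg0 : ∀ i, 0 ≤ g i := fun i => by positivity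
  have hgsum : ∀ n, ∑ i ∈ range n, g i ≤ 2 * d * V / π ^ 2 * (1 / N) := by
    intro n
    rw [← Finset.mul_sum]
    refine mul_le_mul_of_nonneg_left ((sum_inv_succ_sq_shift_le hN n).trans (sub_le_self _ (by positivity))) (by positivity)
  have hgS : Summable g := summable_of_sum_range_le hg0 hgsum
  have hgT : ∑' i, g i ≤ 2 * d * V / π ^ 2 * (1 / N) := Real.tsum_le_of_sum_range_le hg0 hgsum
  have hup : h s - 1 / d * (∫ u in (0 : ℝ)..d, h u) - ∑ m ∈ range N, f m ≤ ∑' i, g i :=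
    hasSum_le (fun i => (le_abs_self _).trans (hfg i)) htail hgS.hasSum
  have hlow : -(∑' i, g i) ≤ h s - 1 / d * (∫ u in (0 : ℝ)..d, h u) - ∑ m ∈ range N, f m := by
    have := hasSum_le (fun i => (neg_le.2 ((neg_le_abs _).trans (hfg i)) : -g i ≤ f (i + N))) hgS.hasSum.neg htail
    simpa using this
  rw [show h s - (1 / d * (∫ u in (0 : ℝ)..d, h u) + ∑ m ∈ range N, f m) =
      h s - 1 / d * (∫ u in (0 : ℝ)..d, h u) - ∑ m ∈ range N, f m by ring]
  refine abs_le.2 ⟨?_, ?_⟩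
  · calc -(2 * d * V / (π ^ 2 * N)) = -(2 * d * V / π ^ 2 * (1 / N)) := by ring
      _ ≤ -(∑' i, g i) := neg_le_neg hgT
      _ ≤ _ := hlow
  · calc _ ≤ ∑' i, g i := hup
      _ ≤ 2 * d * V / π ^ 2 * (1 / N) := hgT
      _ = 2 * d * V / (π ^ 2 * N) := by ring

end Summit.QuantumFields.YangMills.Theorems.BalabanUVNodesN19CosineSeriesSmooth

end
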